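import Summits.CriticalPhenomena.Ising3D.ExclusionSentencesGFD

/-!
# `GFD` / NAMED-late-3: 2D control, validation box, and the LeClair 2006 values

Companion of `ExclusionSentencesGFD.lean` (cell `pub-ising3x`, recog-1; quarantined supplement
`HOME/frozen/FAMILIES-v1-NAMED-late-3.json`).  HONEST FRAMING: lottery ticket; floor = tightest
certified 3D Ising CFT bounds; no exact-solution claim without a proof.

* 2D control (`decide +kernel`): in `[0.12, 0.13] × [0.98, 1.02]` the only `d = 2` member of Kaupužs'
  table is `(K, L) = (8, 4)` = Onsager's `(1/8, 1)` = the author's own `(m, j) = (3, 0)`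
  (`gfdExcluded2_control`, `control_pair_gfd2_unique`, non-vacuity `gfdExcluded2_control_minimal`).
* Synthetic `d = 3` validation box `[0.55, 0.56] × [1.70, 1.74]` (no Ising digit): complete index list
  `[(10, 7)]` = the member `(11/20, 17/10)`; minimality; a too-small `Kmax` is rejected by the checker;
  refinement instance (empty sub-box, no re-scan).
* LeClair 2006 (arXiv:cond-mat/0610817; withdrawn by LeClair–Neubert, JHEP 10 (2007) 027): the late
  values `namedSigmaLate3 = [13/25]`, `namedPairsLate3 = [(13/25, 7/5)]` (`Sp(−2)₃` lowest order:
  `ν = 5/8`, `β = 13/40`), bookkeeping (`13/25 ∉ namedSigma`, `7/5 ∈ namedEps`, pair inside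
  `W = [0.505, 0.535] × [1.2, 1.6]`), and the enclosure corollaries `sigma_ne_leclair_of_isingEnclosure`
  (`b < 13/25`: an island-class face) / `leclairPair_not_attained_of_isingEnclosure` (box misses the
  pair on any face; content because the pair is in `W`).
Twin: `HOME/pub-ising3x-recog-1/lean/tools/gfd_exceptions.py`.  No `native_decide`, no new axioms.
-/

namespace Summit.CriticalPhenomena.Ising3D

open Literature.MathematicalPhysics.QuantumFieldTheory.ConformalBootstrap3D

/-! ### 2D control and a synthetic validation box (`decide +kernel`; no 3D digit) -/

/-- **2D control, joint width `10⁻²`.** In `[0.12, 0.13] × [0.98, 1.02]` the only `d = 2` member of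
Kaupužs' table (`K ≤ 8` verified sufficient) is `(K, L) = (8, 4)`, i.e. Onsager's `(1/8, 1)` — the
author's own `(m, j) = (3, 0)`.  Twin: `gfd_exceptions.py --d 2 --lo-s 0.12 --hi-s 0.13 --lo-e 0.98
--hi-e 1.02`. -/
theorem gfdExcluded2_control :
    gfdExcluded2 8 (12 / 100) (13 / 100) (98 / 100) (102 / 100) [(8, 4)] = true := by
  decide +kernel

/-- Non-vacuity: with the empty list the same check fails. -/
theorem gfdExcluded2_control_minimal :
    gfdExcluded2 8 (12 / 100) (13 / 100) (98 / 100) (102 / 100) [] = false := by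
  decide +kernel

/-- **Printed shape of the 2D control.** A `d = 2` member of Kaupužs' table within `[0.12, 0.13] ×
[0.98, 1.02]` IS Onsager's `(1/8, 1)`. -/
theorem control_pair_gfd2_unique {v : ℚ × ℚ} (hv : v ∈ gfdFamily2) (h1 : 12 / 100 ≤ v.1)
    (h2 : v.1 ≤ 13 / 100) (h3 : 98 / 100 ≤ v.2) (h4 : v.2 ≤ 102 / 100) : v = (1 / 8, 1) := by
  obtain ⟨K, L, hK, hL, hLK, rfl⟩ := hv
  have hmem := gfdExcluded2_sound gfdExcluded2_control hK hL hLK h1 h2 h3 h4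
  simp only [List.mem_singleton, Prod.mk.injEq] at hmem
  obtain ⟨rfl, rfl⟩ := hmem
  exact gfdPair2_onsager

/-- Synthetic `d = 3` validation box `[0.55, 0.56] × [1.70, 1.74]` (centre not an Ising digit; `Kmax =
10`): the complete index list is `[(10, 7)]`, i.e. the member `(11/20, 17/10)` (`(m, j) = (2, 4)`).
Twin: `gfd_exceptions.py --lo-s 0.55 --hi-s 0.56 --lo-e 1.70 --hi-e 1.74` (routes A = B). -/
theorem gfdExcluded3_validation :
    gfdExcluded3 10 (55 / 100) (56 / 100) (170 / 100) (174 / 100) [(10, 7)] = true := by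
  decide +kernel

/-- Minimality of the validation list. -/
theorem gfdExcluded3_validation_minimal :
    gfdExcluded3 10 (55 / 100) (56 / 100) (170 / 100) (174 / 100) [] = false := by
  decide +kernel

/-- The validation member is `(11/20, 17/10)`. -/
theorem gfdPair3_ten_seven : gfdPair3 10 7 = (11 / 20, 17 / 10) := by
  norm_num [gfdPair3]

/-- A too-small `Kmax` is rejected by the checker itself (here `Kmax = 9 < 10`). -/
theorem gfdExcluded3_validation_kmax_rejected :
    gfdExcluded3 9 (55 / 100) (56 / 100) (170 / 100) (174 / 100) [(10, 7)] = false := by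
  decide +kernel

/-- Refinement instance: the sub-box `[0.552, 0.56] × [1.70, 1.74]` contains NO member (read off the
validation list by `gfd3_listed_of_subbox`). -/
theorem validation_subbox_not_gfd3 {K L : ℕ} (hK : 3 ≤ K) (hL : 1 ≤ L) (hLK : L + 2 ≤ K)
    (h1 : 552 / 1000 ≤ (gfdPair3 K L).1) (h2 : (gfdPair3 K L).1 ≤ 56 / 100)
    (h3 : 170 / 100 ≤ (gfdPair3 K L).2) (h4 : (gfdPair3 K L).2 ≤ 174 / 100) : False := by
  have hm := gfd3_listed_of_subbox gfdExcluded3_validation (by norm_num) le_rfl le_rfl le_rfl hK hL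
    hLK h1 h2 h3 h4
  have he : ([(10, 7)].filter fun e : ℕ × ℕ => decide ((552 / 1000 : ℚ) ≤ (gfdPair3 e.1 e.2).1 ∧
      (gfdPair3 e.1 e.2).1 ≤ 56 / 100 ∧ (170 / 100 : ℚ) ≤ (gfdPair3 e.1 e.2).2 ∧
        (gfdPair3 e.1 e.2).2 ≤ 174 / 100)) = [] := by
    decide +kernel
  rw [he] at hm
  simp at hm

/-! ### LeClair 2006: the late NAMED values and their enclosure corollaries -/

/-- NAMED-late-3 `Δ_σ` value: `13/25` (LeClair 2006, `Sp(−2)₃` lowest order: `β/ν = (13/40)/(5/8)`;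
withdrawn by LeClair–Neubert 2007).  Not in `namedSigma`. -/
def namedSigmaLate3 : List ℚ := [13 / 25]

/-- NAMED-late-3 pair: `(13/25, 7/5)` (LeClair 2006; `Δ_ε = 3 − 1/ν`, `ν = 5/8`). -/
def namedPairsLate3 : List (ℚ × ℚ) := [(13 / 25, 7 / 5)]

/-- Bookkeeping: `13/25` is new, `7/5` is the series-era/Mojumder value already in `namedEps`, and the
pair lies inside the cell's window `W = [0.505, 0.535] × [1.2, 1.6]` (SCOPE §2 `### boot-1 v1.2`). -/
theorem namedLate3_bookkeeping :
    (13 / 25 : ℚ) ∉ namedSigma ∧ (7 / 5 : ℚ) ∈ namedEps ∧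
      ((505 / 1000 : ℚ) ≤ 13 / 25 ∧ (13 / 25 : ℚ) ≤ 535 / 1000 ∧ (12 / 10 : ℚ) ≤ 7 / 5 ∧
        (7 / 5 : ℚ) ≤ 16 / 10) := by
  refine ⟨by norm_num [namedSigma], by norm_num [namedEps], by norm_num⟩

/-- **LeClair's `Δ_σ = 13/25` alone**: refuted under any enclosure whose `Δ_σ`-projection stays below
`13/25 = 0.52` (an island-class upper face; no strip or far-field rung of SCOPE §6 reaches it). -/
theorem sigma_ne_leclair_of_isingEnclosure {W R : Set (ℝ × ℝ)} (h : IsingEnclosure W R) {b : ℚ}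
    (hR : ∀ q ∈ R, q.1 ≤ (b : ℝ)) (hb : b < 13 / 25) (D : SigmaEpsilonData)
    (hD : D.SatisfiesBootstrapAxioms) (hW : (D.Δσ, D.Δε) ∈ W) : D.Δσ ≠ 13 / 25 := by
  have hb' : (b : ℝ) < 13 / 25 := by
    rw [show (13 / 25 : ℝ) = ((13 / 25 : ℚ) : ℝ) by norm_num]; exact_mod_cast hb
  exact sigma_ne_of_isingEnclosure h (fun q hq e => absurd (e ▸ hR q hq) (not_le.mpr hb')) D hD hW

/-- **LeClair's pair `(13/25, 7/5)`**: under `IsingEnclosure W R` with `R` inside `[a, b] × [c, d]` and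
the box missing the pair on ANY face (`b < 13/25 ∨ 13/25 < a ∨ d < 7/5 ∨ 7/5 < c`), no admissible datum
in the window sits at it — CONTENT because the pair lies in `W` (the caller supplies `hvW`). -/
theorem leclairPair_not_attained_of_isingEnclosure {W R : Set (ℝ × ℝ)} (h : IsingEnclosure W R)
    {a b c d : ℚ}
    (hR : ∀ q ∈ R, ((a : ℝ) ≤ q.1 ∧ q.1 ≤ (b : ℝ)) ∧ ((c : ℝ) ≤ q.2 ∧ q.2 ≤ (d : ℝ)))
    (hmiss : b < 13 / 25 ∨ 13 / 25 < a ∨ d < 7 / 5 ∨ 7 / 5 < c)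
    (hvW : ((13 / 25 : ℝ), (7 / 5 : ℝ)) ∈ W) (D : SigmaEpsilonData)
    (hD : D.SatisfiesBootstrapAxioms) : (D.Δσ, D.Δε) ≠ (13 / 25, 7 / 5) := by
  refine point_not_attained_of_isingEnclosure h hvW ?_ D hD
  intro hvR
  obtain ⟨⟨h1, h2⟩, h3, h4⟩ := hR _ hvR
  have e1 : ((13 / 25 : ℚ) : ℝ) = 13 / 25 := by norm_num
  have e2 : ((7 / 5 : ℚ) : ℝ) = 7 / 5 := by norm_num
  rcases hmiss with hm | hm | hm | hm
  · have : (b : ℝ) < 13 / 25 := by rw [← e1]; exact_mod_cast hm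
    exact absurd h2 (not_le.mpr this)
  · have : (13 / 25 : ℝ) < a := by rw [← e1]; exact_mod_cast hm
    exact absurd h1 (not_le.mpr this)
  · have : (d : ℝ) < 7 / 5 := by rw [← e2]; exact_mod_cast hm
    exact absurd h4 (not_le.mpr this)
  · have : (7 / 5 : ℝ) < c := by rw [← e2]; exact_mod_cast hm
    exact absurd h3 (not_le.mpr this)

end Summit.CriticalPhenomena.Ising3D
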